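import Mathlib
import Summits.QuantumFields.YangMills.Theorems.TransportFieldPolyakovLineSurgery
import HarnessLib

/-!
# Crux `TransportFieldFano.CoherentToronFloor` ⟨stmt-QuantumFields-23352⟩, line `birth` (planner ym-idea-4 g17): the registered stub
# `stub_transportDerivative` — CLOSED (the closed form of the transport derivative of the torelon deviation)

`TransportDerivativeP`: `⟨(XF)Ω, Ω⟩ = (16/L²)·⟨GΩ, Ω⟩` with `G = Σ_x (Re tr P_x/2)(Re tr W_x/2)(v(P_x)·v(W_x))`.  In fact the identity holds
POINTWISE: `XF(U) = (16/L²) G(U)` (`transportDeriv_torelonDev_eq`).  For the shift of the link `(x,0)` in the fixed direction `a = b(W_x(U))`,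
the `L` Polyakov words through that link (base points `x+ê₀+kê₀`, `card_online`) all have trace `tr(ρ(P_x) exp(t·su2Coord a))` (word surgery,
kit tranche 6 `trace_su2Rep_lineHolonomy_online`), the other `L³ − L` words are constant (`lineHolonomy_update_offline'`); differentiating
`4 − (Re tr)²` at `t = 0` and using the Pauli identity `Re tr(M su2Coord b) = −2Σ b_a Re(−i/2 tr(σ_aM))` (`re_trace_mul_su2Coord`) gives
`∂_x F(U) = (4/L²)·Re tr P_x · Re tr W_x · (v(P_x)·v(W_x))`.
HONEST FRAMING: the crux (its neighbour-coherence floor) is OPEN; K2a and the YM mass gap are NOT proved.  No `sorry`, no new axiom; the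
`abbrev` is a registered-stub copy (verbatim), not a citable fact.  References: [cite: Balaban1985UV3, p. 260]; [cite: Luscher1983, §2].
-/

set_option autoImplicit false

noncomputable section

open MeasureTheory Filter Topology NormedSpace
open scoped BigOperators Matrix.Norms.Frobenius
open Literature.MathematicalPhysics.QuantumFieldTheory (GaugeConfig Site Edge lineHolonomy wilsonFlow_zero)
open Literature.MathematicalPhysics.QuantumFieldTheory.Balaban1983to89.B10Eq18SigmaSU2 (pauli su2Coord)
open Literature.MathematicalPhysics.QuantumFieldTheory.Balaban1983to89.B10Eq18SigmaSU2Haar (expPauli)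
open Summit.QuantumFields.YangMills.Cruxes.CurvatureAmnesia.WardDefect.SchwingerDyson (hasDerivAt_exp_coe_smul hasDerivAt_reTrace)

namespace Summit.QuantumFields.YangMills.Theorems.TransportFieldFano

open Summit.QuantumFields.YangMills.Theorems.FemtoTransferGap
open Summit.QuantumFields.YangMills.Theorems.TransportField

variable {L : ℕ} [NeZero L]

/-! ## §1 The derivative of the torelon deviation along one link, fixed direction -/

/-- **One summand**: for a base point `y`, the derivative at `0` of `t ↦ 4 − (Re tr ρ(P₀(y)(U_t)))²` along `U_t = U[(x,0) ↦ U_{(x,0)} expPauli(t a)]`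
is `−2 Re tr P · Re tr(ρ(P) su2Coord a)` (`P = P₀(x+ê₀)`) if `y` lies on the `0`-line through `x`, and `0` otherwise. [cite: Luscher1983, §2] -/
theorem hasDerivAt_lineDev (U : GaugeConfig 3 L SU2) (x y : Site 3 L) (a : EuclideanSpace ℝ (Fin 3)) :
    HasDerivAt (fun t : ℝ => 4 - ((su2Rep (lineHolonomy (Function.update U (x, (0 : Fin 3)) (U (x, (0 : Fin 3)) * expPauli (t • a))) 0 L y)).trace.re) ^ 2)
      (if y 1 = x 1 ∧ y 2 = x 2 then
        -(2 * (su2Rep (lineHolonomy U 0 L (x.shift 0))).trace.re *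
          (su2Rep (lineHolonomy U 0 L (x.shift 0)) * su2Coord (WithLp.ofLp a)).trace.re) else 0) 0 := by
  by_cases hy : y 1 = x 1 ∧ y 2 = x 2
  · rw [if_pos hy]
    obtain ⟨k, hk, rfl⟩ := exists_online_param x y hy.1 hy.2
    have hfun : (fun t : ℝ => 4 - ((su2Rep (lineHolonomy (Function.update U (x, (0 : Fin 3)) (U (x, (0 : Fin 3)) * expPauli (t • a))) 0 L
        (x.shift 0 + Pi.single (0 : Fin 3) ((k : ℕ) : ZMod L)))).trace.re) ^ 2) =
        fun t : ℝ => 4 - ((su2Rep (lineHolonomy U 0 L (x.shift 0)) * exp ((t : ℂ) • su2Coord (WithLp.ofLp a))).trace.re) ^ 2 := by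
      funext t
      rw [trace_su2Rep_lineHolonomy_online U x _ hk, su2Rep_expPauli_smul]
    rw [hfun]
    have h1 := hasDerivAt_reTrace (((hasDerivAt_exp_coe_smul (su2Coord (WithLp.ofLp a))).const_mul
      (su2Rep (lineHolonomy U 0 L (x.shift 0)))))
    have h2 := (h1.pow 2).const_sub (4 : ℝ)
    simp only [Complex.ofReal_zero, zero_smul, NormedSpace.exp_zero, Matrix.mul_one] at h2
    refine h2.congr_deriv ?_
    ring
  · rw [if_neg hy]
    have hfun : (fun t : ℝ => 4 - ((su2Rep (lineHolonomy (Function.update U (x, (0 : Fin 3)) (U (x, (0 : Fin 3)) * expPauli (t • a))) 0 L y)).trace.re) ^ 2) =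
        fun _ : ℝ => 4 - ((su2Rep (lineHolonomy U 0 L y)).trace.re) ^ 2 := by
      funext t
      rw [lineHolonomy_update_offline' U x y _ L (not_and_or.mp hy)]
    rw [hfun]
    exact hasDerivAt_const _ _

/-- **The torelon deviation along the shift of one link in a fixed direction**: `d/dt|₀ F(U_t) = L·c_x/|Λ|` with
`c_x = −2 Re tr P_x · Re tr(ρ(P_x) su2Coord a)` — the `L` words through the link contribute `c_x` each, the others nothing. [cite: Luscher1983, §2] -/
theorem hasDerivAt_torelonDev_fixedDir (U : GaugeConfig 3 L SU2) (x : Site 3 L) (a : EuclideanSpace ℝ (Fin 3)) :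
    HasDerivAt (fun t : ℝ => (flowLift 0 (fun u : GaugeConfig 3 1 SU2 => 4 - ((su2Rep (u ((0 : Site 3 1), (0 : Fin 3)))).trace.re) ^ 2)) (Function.update U (x, (0 : Fin 3)) (U (x, (0 : Fin 3)) * expPauli (t • a))))
      ((L : ℝ) * -(2 * (su2Rep (lineHolonomy U 0 L (x.shift 0))).trace.re *
          (su2Rep (lineHolonomy U 0 L (x.shift 0)) * su2Coord (WithLp.ofLp a)).trace.re) /
        (Fintype.card (Site 3 L) : ℝ)) 0 := by
  classical
  have hsum : HasDerivAt (fun t : ℝ => ∑ y : Site 3 L,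
      (4 - ((su2Rep (lineHolonomy (Function.update U (x, (0 : Fin 3)) (U (x, (0 : Fin 3)) * expPauli (t • a))) 0 L y)).trace.re) ^ 2))
      (∑ y : Site 3 L, (if y 1 = x 1 ∧ y 2 = x 2 then
        -(2 * (su2Rep (lineHolonomy U 0 L (x.shift 0))).trace.re *
          (su2Rep (lineHolonomy U 0 L (x.shift 0)) * su2Coord (WithLp.ofLp a)).trace.re) else 0)) 0 :=
    HasDerivAt.fun_sum fun y _ => hasDerivAt_lineDev U x y a
  have hcount : (∑ y : Site 3 L, (if y 1 = x 1 ∧ y 2 = x 2 then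
        -(2 * (su2Rep (lineHolonomy U 0 L (x.shift 0))).trace.re *
          (su2Rep (lineHolonomy U 0 L (x.shift 0)) * su2Coord (WithLp.ofLp a)).trace.re) else 0)) =
      (L : ℝ) * -(2 * (su2Rep (lineHolonomy U 0 L (x.shift 0))).trace.re *
          (su2Rep (lineHolonomy U 0 L (x.shift 0)) * su2Coord (WithLp.ofLp a)).trace.re) := by
    rw [Finset.sum_ite, Finset.sum_const_zero, add_zero, Finset.sum_const, card_online, nsmul_eq_mul]
  rw [hcount] at hsum
  have h := hsum.div_const (Fintype.card (Site 3 L) : ℝ)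
  refine h.congr_of_eventuallyEq (Eventually.of_forall fun t => ?_)
  simp only [flowLift, flowLiftAt, wilsonFlow_zero, polyakovSite]

/-! ## §2 The pointwise closed form `XF = (16/L²) G` -/

/-- `|Λ| = L³` for the three-torus. [folklore] -/
theorem card_site_three (L : ℕ) [NeZero L] : (Fintype.card (Site 3 L) : ℝ) = (L : ℝ) ^ 3 := by
  rw [show Fintype.card (Site 3 L) = L ^ 3 by simp [Site, ZMod.card]]
  push_cast; ring

/-! ## §3 The registered stub -/

/-- The registered stub statement `TransportDerivativeP` of line `birth` of crux ⟨stmt-QuantumFields-23352⟩ (verbatim copy of the skeleton's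
`BirthCTF.TransportDerivativeP`; a registered-stub copy, not a citable fact). -/
abbrev TransportDerivativeP : Prop :=
  ∀ β : ℝ, ∀ (L : ℕ) [NeZero L], 2 ≤ L → ∀ Ω : Literature.MathematicalPhysics.QuantumFieldTheory.GaugeConfig 3 L SU2 → ℝ, IsPhys Ω → l2 Ω Ω = 1 → transferApply β Ω = topValue su2Rep L β • Ω → let W : Literature.MathematicalPhysics.QuantumFieldTheory.Site 3 L → Literature.MathematicalPhysics.QuantumFieldTheory.GaugeConfig 3 L SU2 → SU2 := fun x U => U (x.shift 0, (1 : Fin 3)) * polyakovSite ((x.shift 0).shift 1) U ((0 : Literature.MathematicalPhysics.QuantumFieldTheory.Site 3 1), (0 : Fin 3)) * (U (x.shift 0, (1 : Fin 3)))⁻¹; let b : SU2 → EuclideanSpace ℝ (Fin 3) := fun w => (EuclideanSpace.equiv (Fin 3) ℝ).symm fun i => (su2Rep w).trace.re * (-(Complex.I / 2) * (Literature.MathematicalPhysics.QuantumFieldTheory.Balaban1983to89.B10Eq18SigmaSU2.pauli i * su2Rep w).trace).re; let X : (Literature.MathematicalPhysics.QuantumFieldTheory.GaugeConfig 3 L SU2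 → ℝ) → Literature.MathematicalPhysics.QuantumFieldTheory.GaugeConfig 3 L SU2 → ℝ := fun ψ U => ∑ x : Literature.MathematicalPhysics.QuantumFieldTheory.Site 3 L, deriv (fun t : ℝ => ψ (Function.update U (x, (0 : Fin 3)) (U (x, (0 : Fin 3)) * Literature.MathematicalPhysics.QuantumFieldTheory.Balaban1983to89.B10Eq18SigmaSU2Haar.expPauli (t • b (W x U))))) 0; let F : Literature.MathematicalPhysics.QuantumFieldTheory.GaugeConfig 3 L SU2 → ℝ := flowLift 0 (fun u : Literature.MathematicalPhysics.QuantumFieldTheory.GaugeConfig 3 1 SU2 => 4 - ((su2Rep (u ((0 : Literature.MathematicalPhysics.QuantumFieldTheory.Site 3 1), (0 : Fin 3)))).trace.re) ^ 2); let P : Literature.MathematicalPhysics.QuantumFieldTheory.Site 3 L → Literature.MathematicalPhysics.QuantumFieldTheory.GaugeConfig 3 L SU2 → SU2 := fun x U => polyakovSite (x.shift 0) U ((0 : Literature.MathematicalPhysics.QuantumFieldTheory.Site 3 1), (0 : Fin 3)); let v : SU2 → EuclideanSpace ℝ (Fin 3) := fun w => (EuclideanSpace.equiv (Fin 3) ℝ).symm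 fun i => (-(Complex.I / 2) * (Literature.MathematicalPhysics.QuantumFieldTheory.Balaban1983to89.B10Eq18SigmaSU2.pauli i * su2Rep w).trace).re; let G : Literature.MathematicalPhysics.QuantumFieldTheory.GaugeConfig 3 L SU2 → ℝ := fun U => ∑ x : Literature.MathematicalPhysics.QuantumFieldTheory.Site 3 L, ((su2Rep (P x U)).trace.re / 2) * ((su2Rep (W x U)).trace.re / 2) * (∑ i : Fin 3, v (P x U) i * v (W x U) i); l2 (fun U => X F U * Ω U) Ω = 16 / (L : ℝ) ^ 2 * l2 (fun U => G U * Ω U) Ω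

/-- ★★ **`stub_transportDerivative`** (registered stub of the birth skeleton of crux ⟨stmt-QuantumFields-23352⟩, signature
`TransportDerivativeP` verbatim): `⟨(XF)Ω, Ω⟩ = (16/L²)⟨GΩ, Ω⟩`, from the pointwise closed form of `XF`. [cite: Luscher1983, §2]
[cite: Balaban1985UV3, p. 260] -/
theorem stub_transportDerivative : TransportDerivativeP := by
  intro β L _ hL Ω hΩ _hn _heig
  dsimp only
  have hL0 : (L : ℝ) ≠ 0 := by exact_mod_cast (NeZero.ne L)
  have happ : ∀ (f : Fin 3 → ℝ) (i : Fin 3), ((EuclideanSpace.equiv (Fin 3) ℝ).symm f) i = f i := fun f i => rfl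
  have hofLp : ∀ f : Fin 3 → ℝ, WithLp.ofLp ((EuclideanSpace.equiv (Fin 3) ℝ).symm f) = f := fun f => rfl
  unfold l2
  rw [← integral_const_mul]
  refine integral_congr_ae (ae_of_all _ fun U => ?_)
  dsimp only
  rw [Finset.sum_congr rfl fun x _ => (hasDerivAt_torelonDev_fixedDir U x _).deriv, card_site_three]
  have key : ∀ S₁ S₂ : ℝ, S₁ = 16 / (L : ℝ) ^ 2 * S₂ → S₁ * Ω U * Ω U = 16 / (L : ℝ) ^ 2 * (S₂ * Ω U * Ω U) := by
    intro S₁ S₂ h; rw [h]; ring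
  refine key _ _ ?_
  rw [Finset.mul_sum]
  refine Finset.sum_congr rfl fun x _ => ?_
  rw [re_trace_mul_su2Coord]
  simp only [happ, polyakovSite, mul_neg, neg_mul, Finset.mul_sum]
  rw [Finset.sum_neg_distrib, neg_neg, Finset.sum_div]
  refine Finset.sum_congr rfl fun i _ => ?_
  field_simp
  ring

end Summit.QuantumFields.YangMills.Theorems.TransportFieldFano

end
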